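import Mathlib
import HarnessLib
import HarnessLib.Audit
import Summits.KontsevichZagierPeriods.Statement
import HarnessLib.Audit.Status.Attr

/-!
Route: ExponentCosets

DORMANT since 2026-08-23T16:06:22Z (reconciler: no traction for 6.1 d (last activity item-proof-filed at 2026-08-17T12:54:15Z); parked, not closed — `ledger route dormant route-KontsevichZagierPeriods-ExponentCosets --off` to reactivate) — unstaffed, not closed; items shared with open routes are served there. `ledger route dormant <id> --off` reactivates.

# Route ExponentCosets — Deform the exponent II — Conjecture 1 splits by pure logic into
IBP-complete exponent cosets and a cross-coset dévissage of coverings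

Realises card mellin-exponent-deformation-ibp (gen 2; its first route MellinExponentDeformation was
retired not-a-thesis because it
stopped at a Gauss-family sector). Grade the WHOLE calculus of moves by MELLIN FIBRES: a box-Mellin
member is a representation
[ (0,1)^m ∩ {g_k > 0}, κ·∏_k g_k^{e_k} ] (g_k ∈ ℚ[x], e_k ∈ ℚ, κ ∈ ℚ, absolutely convergent); its
family is the tuple g, its fibre
(exponent coset) is e + ℤ^K — the members of one fibre are exactly the periods of ONE rank-one local
system on the box relative to
its faces. Two facts of the tree make this grading universal and divisible: every formal combination
is ≡ (mod KZ.relations) a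
ℤ-combination of members (MellinAccessibility, support, from Viu-Sos' bounded reduction PROVED in
the tree + sign cells), and
P_KZ is torsion-free (TorsionFree, support, shared). It then suffices to show X = X1 ∧ X2:
(X1, CosetKernel) Conjecture 1 INSIDE ONE FIBRE — every vanishing ℤ-combination of members of one
coset of one family is a relation;
here integration by parts with RADICAL certificates A·∏g_k^{p_k/q_k} is the complete engine at
generic exponent (Aomoto–Kita,
Bitoun–Bogner–Klausen–Panzer; value-level shift relations on semialgebraic domains: Belkale–Brosnan)
and what it leaves is ONE
transcendence statement per fibre (ℤ-independence of master values); (X2, CosetDevissage) ACROSS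
FIBRES — every vanishing combination of
members is, up to an integer multiple and modulo KZ.relations, a SUM of vanishing single-fibre
combinations: cross-fibre identities
(dilations = Kummer/Fermat coverings, reflections, Gauss multiplication, CM correspondences) are
moves up to in-fibre slack.
Lean: `CosetDevissage ∧ CosetKernel`

## Assembly
Pure logic plus the PROVED soundness
`Literature.NumberTheory.Transcendental.KZ.relations_le_ker_eval_holds` (sorry-free in Sketch.lean,
axioms propext · Classical.choice · Quot.sound; filed as the deciding theorem `closes (hA :
MellinAccessibility) (hD : CosetDevissage)
(hK : CosetKernel) (hT : TorsionFree) : KontsevichZagierPeriods`): given rational r, r′ with r.value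
= r′.value put c = [r] − [r′], so
eval c = 0; MellinAccessibility gives c′ in the Mellin span with c − c′ ∈ relations, hence eval c′ =
0 by soundness; CosetDevissage gives
N ≠ 0 and vanishing single-fibre combinations cs_j with N•c′ − Σ cs_j ∈ relations; CosetKernel puts
every cs_j in relations, so N•c′ ∈
relations; TorsionFree gives c′ ∈ relations, hence c ∈ relations, i.e. KZ.Equivalent r r′.
BoxIBPTransfer and BetaCosetKZ are the engine
and the calibration of CosetKernel and are not hypotheses of `closes`.

Rationale: WHY THIS LINE. Every other line on this summit deforms the GEOMETRY (GaussManinCertificates,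
AyoubSpecialisation), fixes the exponent and reduces in the
polynomial direction (HermiteRigidity), or widens the calculus (ExpConservative, WeightLine); this
one deforms the EXPONENT, the one
direction in which completeness of a sub-calculus is a THEOREM: at generic s the ℚ(s)-relations
among ∫σ A·∏g_k^{s_k} are generated by
shifts/IBP (AomotoKita2011 §4.3.1; BitounEtAl2018 Lemma 7, Cor. 14, Cor. 18: Mellin transform =
bijection between annihilating shift
operators and parametric annihilators, #masters = Euler characteristic; BelkaleBrosnan2003 Thm 1.8:
Σ c_i(s) I(s+i) = 0, c_i ∈ ℚ[s], for
I(s) = ∫_C f^s ω on any compact semialgebraic C, by Picard–Fuchs + Carleson), and specialising at a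
RATIONAL fibre lands on g^{p/q}, a
ℚ-semialgebraic function — an admissible rule-3 primitive, which is where "algebraic functions" in
Conjecture 1 come from. The new step
over the retired route is the GRADING ITSELF: in Huber–Wüstholz' formalism the Period Conjecture for
an abelian category splits into
single objects plus morphisms (HuberWustholz2022 Lemma 7.20, Cor. 7.21, Thm 9.10); transplanted to
KZ's presented group graded by
(family, coset) this is the pure-logic split X1 (End-type, one twisted box motive) ∧ X2 (Hom-type,
correspondences between them), and
the deciding theorem closes the SUMMIT, not a sector. Imported areas: D-module / IBP reduction
technology of Feynman integrals (reduction
algorithms become move generators for X1), transcendence of 1-periods (fibres of dimension one: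
HuberWustholz2022 Thm 9.10, Wolfart1988),
Rohrlich–Lang / Deligne's Γ-distribution structure (Deligne1982HodgeCycles §7, Waldschmidt2006) as
the map of X2 on the Beta families.
Negatives index (1 entry, KinematicPlaneConvex) is unrelated.

RANKED CRUXES. #2 CosetDevissage (crux) — CROSS-FIBRE DÉVISSAGE (card H5 "MellinLifting" + the M and
R generators, typed over the whole calculus): for every ℤ-combination c of box-Mellin members with
value 0 there are N ≥ 1 and finitely many single-fibre combinations cs_j (all members of cs_j in one
exponent coset of one family, each cs_j of value 0) with N•c − Σ_j cs_j ∈ KZ.relations. Informal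
content: every identity BETWEEN fibres is realised by moves — dilations x_j ↦ x_j^k (Kummer/Fermat
coverings, rule 2), affine symmetries of the box (reflection), Fubini products, algebraic
correspondences as dissected sheetwise changes of variables — up to identities inside fibres; the
Hom-part of the Period Conjecture for the twisted box motives. [difficulty: open-problem] (why it
might fail: a cross-fibre identity realised by no chain of algebraic correspondences plus in-fibre
slack breaks it; first tests: Gauss multiplication B(1/9,4/9)B(5/9,7/9) = 2·3^(7/6)·π (pair 0312)
and Chowla–Selberg (Γ-products = CM elliptic periods).) [HuberWustholz2022, Deligne1982HodgeCycles,
Waldschmidt2006, AndrewsAskeyRoy1999, KontsevichZagier2001, BitounEtAl2018]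
#3 CosetKernel (crux) — CONJECTURE 1 INSIDE ONE FIBRE (card H1 + the T generator; generalises the
retired GaussFibreKZ to every family): for a family g = (g_1,…,g_K) ⊂ ℚ[x_1..x_m], a coset
representative e₀ ∈ ℚ^K and finitely many members r_i = [ (0,1)^m ∩ {g > 0}, κ_i ∏ g_k^{e₀_k + ν_ik}
] (ν_i ∈ ℤ^K, κ_i ∈ ℚ), every ℤ-combination Σ a_i [r_i] of value 0 lies in KZ.relations. Attack:
(reduction) Laporta/contiguity reduction to finitely many masters INSIDE the calculus by IBP with
radical certificates (BoxIBPTransfer) — the specialisation at the rational fibre of the ℚ[s]-shift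
relations, which generate everything at generic s; (rigidity) ℤ-independence of the master values of
the fibre = periods of one rank-one local system over one cycle (dimension one: analytic subgroup
theorem range). [deps: BoxIBPTransfer] [difficulty: open-problem] (why it might fail: a fibre with a
value relation that is neither a specialised ℚ[s]-shift relation nor excluded by fibre
transcendence: finite-monodromy (Schwarz-list) Gauss fibres with E′/E ∈ ℚ at rational z, or resonant
integer fibres where c_0(s₀) = 0 and IBP boundary terms drop exponents.) [BitounEtAl2018,
AomotoKita2011, BelkaleBrosnan2003, Wolfart1988, HuberWustholz2022, KontsevichZagier2001]
#4 BoxIBPTransfer (crux) — THE ENGINE (card H1 "ShiftTransfer", verbatim the retired route's item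
stmt-KontsevichZagierPeriods-3721 so the ledger row is shared): on the open unit box let F = A·∏_k
g_k^{s_k} with A, g_k ∈ ℚ[x_1…x_n], g_k > 0 on the open box, s_k ∈ ℚ; if F tends to 0 at both ends
of every fibre in direction i, then [ (0,1)^n, ∂_iF ] (absolute integrability part of the datum) is
a KZ relation — Bitoun–Bogner–Klausen–Panzer's differentiation rule of the Mellin transform (Lemma
7) turned into one Newton–Leibniz move with a RADICAL, hence ℚ-semialgebraic, primitive after
reindexing i last (KZ.IntegralRep.of_sub_of_reindex_mem_relations, proved) plus two null faces.
[difficulty: L] (why it might fail: newtonLeibnizRel wants the primitive ℚ-semialgebraic on the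
CLOSED band and continuous on closed fibres: extending A·∏g_k^(s_k) by 0 to faces where some g_k
vanishes with s_k < 0 is semialgebraic, but fibrewise limits alone may not give the
IsSemialgebraicFunOn witness.) [BitounEtAl2018, KontsevichZagier2001,
Literature.NumberTheory.Transcendental.KZ.newtonLeibnizRel,
Literature.NumberTheory.Transcendental.KZ.IntegralRep.of_sub_of_reindex_mem_relations]
#9 MellinAccessibility (support) — UNIVERSALITY OF THE GRADING: every formal combination c is
congruent modulo KZ.relations to a ℤ-combination of box-Mellin members. Proof plan (all ingredients
in the tree): c ≡ [r] − [r′] (KZ.exists_integralRep_sub_holds); each [r] ≡ [A,1] − [B,1] with A, B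
BOUNDED (KZ.exists_sub_isBounded, Viu-Sos' bounded reduction, PROVED); an affine map puts A inside
(0,1)^d (KZ.of_sub_of_mem_changeOfVariablesRel_linear + translation); a ℚ-semialgebraic A ⊂ (0,1)^d
is, off the null set ∪{h_l = 0} of its describing polynomials (tarski_seidenberg_real_holds), the
disjoint union of open sign cells {ε_l h_l > 0} ∩ (0,1)^d (rule 1a; null sets are relations), and
[cell, 1] is the member with g = (ε_l h_l), e = 0, κ = 1. [difficulty: L] [ViuSos2021,
KontsevichZagier2001, Literature.NumberTheory.Transcendental.KZ.exists_sub_isBounded,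
Literature.NumberTheory.Transcendental.KZ.exists_integralRep_sub_holds]
#9 TorsionFree (support) — P_KZ = FormalRep ⧸ KZ.relations is torsion-free: n ≠ 0, n • c ∈ relations
⇒ c ∈ relations (scale integrands by 1/n: cut an auxiliary unit interval into n slabs;
KZ.mul_mem_relations_right_holds). Verbatim the shared item stmt-KontsevichZagierPeriods-3169
(routes CoactionDevissage, MellinExponentDeformation); needed to divide the integer N of
CosetDevissage. [difficulty: provable-now] [KontsevichZagier2001,
Literature.NumberTheory.Transcendental.KZ.integrandAddRel,
Literature.NumberTheory.Transcendental.KZ.mul_mem_relations_right_holds]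
#9 BetaCosetKZ (support) — CALIBRATION, the first fibres settled unconditionally (verbatim the
retired route's stmt-KontsevichZagierPeriods-3722): Conjecture 1 holds for any two members
κ·x^(a+i−1)(1−x)^(b+j−1), κ′·x^(a+i′−1)(1−x)^(b+j′−1) of one coset of the Beta family on (0,1) — all
values of a coset are rational multiples of one Beta value by the translation relations B(a+1,b) =
a/(a+b)·B(a,b) (one IBP with primitive x^a(1−x)^b + rule 1b), the T generator of Rohrlich–Lang
realised as moves; the two-member instance of CosetKernel for g = (x, 1−x). [difficulty: M]
[AndrewsAskeyRoy1999, Waldschmidt2006, KontsevichZagier2001]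

TWO-LAYER PLAN. CosetKernel ⇐ per family, k ≤ 3 children each time a fibre closes: (Gauss family,
first) GaussMasterReduction → GaussMasterIrrational →
CosetKernel|Gauss — the retired route's typed decls stmt-KontsevichZagierPeriods-3720/3719
(closed·moot, signatures reusable verbatim),
with the Legendre coset (1/2,1/2,1) shared with HermiteRigidity as calibration; then the ζ-simplex
families (1 − x_1⋯x_m) whose integer
fibres carry 1, ζ(2), ζ(3), … (reduction = Beukers/Apéry-type IBP; rigidity =
irrationality/independence, open beyond ζ(3)).
CosetDevissage ⇐ (DilationTransfer: x_j ↦ x_j^k between members is one rule-2 move, provable now) →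
(DistributionDevissage: Gauss
multiplication at denominator q reduces mod moves to in-fibre identities — pair 0312 first, engine
shared with MultivaluedCoV.SheetTransfer
and MellinCoarea.TriplicationFibreTransfer) → CosetDevissage. BoxIBPTransfer ⇐ (last coordinate: one
newtonLeibnizRel + null faces) →
(reindex) → BoxIBPTransfer.

KILL CRITERIA. A refutation of BoxIBPTransfer (an IBP identity with radical certificate, both sides
convergent, NOT in KZ.relations) kills the line
outright: close `refuted:BoxIBPTransfer` and hand route Neg the pair. A refutation of CosetKernel at
a specific fibre (a within-fibre value
relation not derivable) refutes the SUMMIT unless mis-stated — it would be the sharpest candidate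
counterexample to Conjecture 1 on record;
the route then closes with every positive route. A refutation of CosetDevissage with CosetKernel
standing exhibits a cross-fibre identity
that needs a non-algebraic bridge: pivot X2 to "modulo named transcendental correspondences" or
retire `refuted:CosetDevissage`.
MellinAccessibility refuted (some combination not reachable by bounded reduction + sign cells)
forces a restatement of the member class
(orthant members), not a close. A proof of the kernel conjecture by any other route moots X1 and X2
but not the engine.

NOT DECOMPOSED YET. The per-family master sets and convergence-wall analysis of CosetKernel (only
the Gauss family was typed, in the retired route);
resonant fibres (integer cosets: b-function roots, Laurent coefficients of Igusa zeta functions,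
BelkaleBrosnan2003 Thm 1.8) versus
non-resonant ones; the intrinsic characterisation of "same fibre" (same domain, integrand ratio in
ℚ(x)) versus the presentational one
used in the Lean text (a definition request will fix vocabulary once a prover needs it); orthant /
Lee–Pomeransky members (x ↦ x/(1−x)
brings them to the box); which cross-fibre identities need genuine correspondences rather than
monomial maps (left to MultivaluedCoV /
MellinCoarea engines); any use of reflection s ↦ −s as an intersection pairing (quadratic identities
appear as members of product families).

CHEAPEST FALSIFIER. (i) BoxIBPTransfer, smallest instance n = 1, K = 2, g = (x, 1−x), s = (1/2,
1/2), A = 1: is [ (0,1), (1−2x)/(2√(x(1−x))) ] ∈ KZ.relations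
by ONE newtonLeibnizRel move with F = √(x(1−x)) (KZ 2001 §1.1's own example)? If the Lean side
conditions refuse it the engine is
mis-stated. (ii) CosetKernel at the cheapest non-Beta fibre: 60-digit PSLQ of
E(a,b,c;z)/E(a+1,b+1,c+1;z) against rationals of height
≤ 10^12 at (a,b,c,z) = (1/3,1/2,5/4,1/2), (1/4,1/3,7/6,−1) (kit pari, minutes; not run from this
compute-free seat) — a rational hit is a
within-fibre relation that must then be DERIVED. (iii) CosetDevissage: does the known chain for
Legendre duplication / the MellinCoarea
triplication plan leave only same-fibre Beta identities as residue? A residue in a THIRD fibre not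
killed by BetaCosetKZ-type reductions
would show the dévissage is mis-cut.

NUMBERS. Rank of the generic fibre module = signed Euler characteristic of the complement
(BitounEtAl2018 §3, after Loeser–Sabbah); Gauss family:
rank 2 (masters E, E′); Beta family: rank 1 (BetaCosetKZ). Shift relation length ≤ d + r
(BelkaleBrosnan2003 eq. (rel2): d = max degree
of the Picard–Fuchs coefficients, r = its order). Test values: B(1/9,4/9)·B(5/9,7/9) = 2·3^(7/6)·π ≈
22.6371 (pair 0312, cross-fibre);
E(1/2,1/2,1;λ) vs E(3/2,3/2,2;λ): ratio irrational for every rational λ ∈ (0,1) (Masser 1975),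
in-fibre calibration. Items at open: 7.

DEFINITION REQUESTS. Foreseen, not filed at open (the items inline the predicates so they elaborate
today): `MellinMember` / `mellinSpan` / `IsFibreCombination`
vocabulary under Literature/NumberTheory/Transcendental (box-Mellin members, their span in
KZ.FormalRep, single-fibre combinations), to be
requested with `ledger workitem add --kind definition` as soon as a prover or grounder asks; the
1-period vocabulary for dimension-one
fibres is the pending request of LowDimension 0510 (interim OnePeriods.lean).

Novelty: Searches (2026-08-15): `lit search --hybrid --no-graph "Mellin transform Feynman integral
annihilators integration by parts Bernstein Sato"`
(10 docs, integral-transform textbooks and QCD, nothing on periods); `lit search --hybrid --no-graph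
"Igusa local zeta function periods Laurent
coefficients Belkale Brosnan"` (8 docs, none relevant; paper fetched directly: `lit read
arxiv:math/0302090`, Thm 1.8 and eqs. (rel2)–(rel4)
read, pp. 3–6); `lit search --hybrid --no-graph "twisted de Rham cohomology contiguity relations
hypergeometric integrals Aomoto Kita"` (8:
AomotoKita2011 held, Haraoka 2020, HuberWustholz2022); `lit search --hybrid --no-graph "linear
relations periods rank one local system …
period conjecture"` (8: HuberWustholz2022 pp. 9–17, Marcolli, Deligne 1970); `lit read
book:huber2022… --grep "induced by bilinearity and
functoriality|Period Conjecture holds"` (Lemma 7.20, Cor. 7.21/7.22/7.32, Thm 9.10 read, pp. 66–71,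
91); `lit galaxy search "Periods and
Igusa local zeta functions" --star all` (9 rows: Marcolli Feynman Motives, André arXiv:0812.3920,
Aluffi–Marcolli); `lit galaxy search
"Feynman integral relations from parametric annihilators" --star all` (9 rows: Frellesvig et al.
arXiv:2008.04823 intersection numbers,
de la Cruz holonomic amplitudes, NeatIBP — physics-side IBP only); `lit galaxy search
"Kontsevich-Zagier conjecture" --star all` (0, cached);
`lit frontier KontsevichZagierPeriods --since 2020` (30 rows; arXiv:2303.05030 GPC for CM Kummer
surfaces the  [refs: math/0302090, 0812.3920, 2008.04823, 2303.05030, 1712.09215, arxiv:math/0302090, book:huber2022, AomotoKita2011, HuberWustholz2022, BitounEtAl2018, BelkaleBrosnan2003]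

Barriers (technique_class: mellin-exponent-deformation, ibp-radical-certificates): - technique_class: mellin-exponent-deformation, ibp-radical-certificates
- Literature.Barriers.KontsevichZagierPeriods.noSemialgebraicPrimitive_inv_sub_two: evaded by
construction in the engine — the only primitives BoxIBPTransfer uses are A·∏g_k^(p_k/q_k),
ℚ-semialgebraic; the barrier's log(2−t) is ∂/∂s of g^s (g = 2−t) and the line never differentiates
in the exponent, it specialises polynomial-in-s identities at rational s; integer (resonant) fibres,
where logarithms = Laurent coefficients genuinely occur (BelkaleBrosnan2003 Thm 1.8), are handled as
members of OTHER families in more variables (log f = ∫₀¹ (f−1)/((f−1)t+1) dt, ibid. p. 5), never as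
primitives.
- Literature.Barriers.KontsevichZagierPeriods.kzConjecture_implies_oddZetaAlgIndep: not evaded,
LOCALISED — ζ(n) and their products are values of integer fibres of the simplex families (1 −
x_1⋯x_m) and of their product families, so the algebraic independence the barrier demands sits
inside named instances of CosetKernel (rigidity half), while the reduction half of those fibres is
provable; the bet is that isolating one transcendence statement per fibre is the right granularity.
- Literature.Barriers.KontsevichZagierPeriods.kzConjecture_implies_twoPiI_log_algIndep: same — π and
log q are values of the fibres e ≡ 0 of the families (1 + x²) and (1 + (q−1)x); their independence
is the rigidity half of CosetKernel for the product family, stated, not assumed.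
- Literature.Barriers.KontsevichZagierPeriods.kzConjecture_impli

History (route lifecycle, newest last):
- 2026-08-23T16:06:22Z · DORMANT — reconciler: no traction for 6.1 d (last activity item-proof-filed at 2026-08-17T12:54:15Z); parked, not closed — `ledger route dormant route-KontsevichZagierPer (operator:999:1035374)

sub-problem: KontsevichZagierPeriods · status: dormant · opened planner-plancard-KontsevichZagierPeriods-Kont-98e2b8a5-g2-0 2026-08-15T18:56:32Z · rev 1 · ledger route-KontsevichZagierPeriods-ExponentCosets
GENERATED by the gate from the ledger (D-0016/17). Provers cite these decls: `theorem foo : Summit.KontsevichZagierPeriods.KontsevichZagierPeriods.Theses.ExponentCosets.<Decl> := …` in Summits/KontsevichZagierPeriods/KontsevichZagierPeriods/Theorems/<Name>.lean.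
-/

namespace Summit.KontsevichZagierPeriods.KontsevichZagierPeriods.Theses.ExponentCosets

open scoped BigOperators Topology Manifold Classical MeasureTheory ProbabilityTheory Matrix InnerProductSpace ComplexConjugate ContinuousMap
open Filter Set Function TopologicalSpace MeasureTheory

attribute [summit_statement] _root_.KontsevichZagierPeriods

open Literature Periods

/-- item stmt-KontsevichZagierPeriods-12833 · crux · rank 2 · open · by planner
why it might fail: a cross-fibre identity realised by no chain of algebraic correspondences plus in-fibre slack breaks it; first tests: Gauss multiplication B(1/9,4/9)B(5/9,7/9) = 2·3^(7/6)·π (pair 0312) and Chowla–Selberg (Γ-products = CM elliptic periods).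
sources: HuberWustholz2022, Deligne1982HodgeCycles, Waldschmidt2006, AndrewsAskeyRoy1999, KontsevichZagier2001, BitounEtAl2018
[crux] CROSS-FIBRE DÉVISSAGE (card H5 "MellinLifting" + the M and R generators, typed over the whole
calculus): for every ℤ-combination c of box-Mellin members with value 0 there are N ≥ 1 and finitely
many single-fibre combinations cs_j (all members of cs_j in one exponent coset of one family, each
cs_j of value 0) with N•c − Σ_j cs_j ∈ KZ.relations. Informal content: every identity BETWEEN fibres
is realised by moves — dilations x_j ↦ x_j^k (Kummer/Fermat coverings, rule 2), affine symmetries of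
the box (reflection), Fubini products, algebraic correspondences as dissected sheetwise changes of
variables — up to identities inside fibres; the Hom-part of the Period Conjecture for the twisted
box motives. [difficulty: open-problem] -/
@[route_item "route-KontsevichZagierPeriods-ExponentCosets", crux]
def CosetDevissage : Prop :=
  ∀ c ∈ AddSubgroup.closure {d : Literature.NumberTheory.Transcendental.KZ.FormalRep | ∃ (m K : ℕ) (g : Fin K → MvPolynomial (Fin m) ℚ) (e : Fin K → ℚ) (κ : ℚ) (r : Literature.NumberTheory.Transcendental.KZ.IntegralRep m), r.domain = {x | (∀ j, x j ∈ Set.Ioo (0:ℝ) 1) ∧ ∀ k, 0 < MvPolynomial.aeval x (g k)} ∧ Set.EqOn r.integrand (fun x => (κ : ℝ) * ∏ k, (MvPolynomial.aeval x (g k)) ^ ((e k : ℚ) : ℝ)) r.domain ∧ d = Literature.NumberTheory.Transcendental.KZ.of r}, Literature.NumberTheory.Transcendental.KZ.eval c = 0 → ∃ N : ℕ, N ≠ 0 ∧ ∃ (J : ℕ) (cs : Fin J → Literature.NumberTheory.Transcendental.KZ.FormalRep), (∀ j, ∃ (m K L : ℕ) (g : Fin K → MvPolynomial (Fin m) ℚ)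 (e₀ : Fin K → ℚ) (ν : Fin L → Fin K → ℤ) (κ : Fin L → ℚ) (a : Fin L → ℤ) (r : Fin L → Literature.NumberTheory.Transcendental.KZ.IntegralRep m), (∀ i, (r i).domain = {x | (∀ j, x j ∈ Set.Ioo (0:ℝ) 1) ∧ ∀ k, 0 < MvPolynomial.aeval x (g k)} ∧ Set.EqOn (r i).integrand (fun x => (κ i : ℝ) * ∏ k, (MvPolynomial.aeval x (g k)) ^ ((e₀ k + (ν i k : ℚ) : ℚ) : ℝ)) (r i).domain) ∧ Literature.NumberTheory.Transcendental.KZ.eval (∑ i, a i • Literature.NumberTheory.Transcendental.KZ.of (r i)) = 0 ∧ cs j = ∑ i, a i • Literature.NumberTheory.Transcendental.KZ.of (r i)) ∧ N • c - ∑ j, cs j ∈ Literature.NumberTheory.Transcendental.KZ.relations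

/-- item stmt-KontsevichZagierPeriods-12834 · crux · rank 3 · open · by planner
why it might fail: a fibre with a value relation that is neither a specialised ℚ[s]-shift relation nor excluded by fibre transcendence: finite-monodromy (Schwarz-list) Gauss fibres with E′/E ∈ ℚ at rational z, or resonant integer fibres where c_0(s₀) = 0 and IBP boundary terms drop exponents.
sources: BitounEtAl2018, AomotoKita2011, BelkaleBrosnan2003, Wolfart1988, HuberWustholz2022, KontsevichZagier2001
[crux] CONJECTURE 1 INSIDE ONE FIBRE (card H1 + the T generator; generalises the retired
GaussFibreKZ to every family): for a family g = (g_1,…,g_K) ⊂ ℚ[x_1..x_m], a coset representative e₀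
∈ ℚ^K and finitely many members r_i = [ (0,1)^m ∩ {g > 0}, κ_i ∏ g_k^{e₀_k + ν_ik} ] (ν_i ∈ ℤ^K, κ_i
∈ ℚ), every ℤ-combination Σ a_i [r_i] of value 0 lies in KZ.relations. Attack: (reduction)
Laporta/contiguity reduction to finitely many masters INSIDE the calculus by IBP with radical
certificates (BoxIBPTransfer) — the specialisation at the rational fibre of the ℚ[s]-shift
relations, which generate everything at generic s; (rigidity) ℤ-independence of the master values of
the fibre = periods of one rank-one local system over one cycle (dimension one: analytic subgroup
theorem range). [deps: BoxIBPTransfer] [difficulty: open-problem] -/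
@[route_item "route-KontsevichZagierPeriods-ExponentCosets", crux]
def CosetKernel : Prop :=
  ∀ (m K L : ℕ) (g : Fin K → MvPolynomial (Fin m) ℚ) (e₀ : Fin K → ℚ) (ν : Fin L → Fin K → ℤ) (κ : Fin L → ℚ) (a : Fin L → ℤ) (r : Fin L → Literature.NumberTheory.Transcendental.KZ.IntegralRep m), (∀ i, (r i).domain = {x | (∀ j, x j ∈ Set.Ioo (0:ℝ) 1) ∧ ∀ k, 0 < MvPolynomial.aeval x (g k)} ∧ Set.EqOn (r i).integrand (fun x => (κ i : ℝ) * ∏ k, (MvPolynomial.aeval x (g k)) ^ ((e₀ k + (ν i k : ℚ) : ℚ) : ℝ)) (r i).domain) → Literature.NumberTheory.Transcendental.KZ.eval (∑ i, a i • Literature.NumberTheory.Transcendental.KZ.of (r i)) = 0 → (∑ i, a i • Literature.NumberTheory.Transcendental.KZ.of (r i)) ∈ Literature.NumberTheory.Transcendental.KZ.relations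

/-- item stmt-KontsevichZagierPeriods-12835 · crux · rank 4 · open · by planner
why it might fail: newtonLeibnizRel wants the primitive ℚ-semialgebraic on the CLOSED band and continuous on closed fibres: extending A·∏g_k^(s_k) by 0 to faces where some g_k vanishes with s_k < 0 is semialgebraic, but fibrewise limits alone may not give the IsSemialgebraicFunOn witness.
sources: BitounEtAl2018, KontsevichZagier2001, Literature.NumberTheory.Transcendental.KZ.newtonLeibnizRel, Literature.NumberTheory.Transcendental.KZ.IntegralRep.of_sub_of_reindex_mem_relations
[crux] THE ENGINE (card H1 "ShiftTransfer", verbatim the retired route's item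
stmt-KontsevichZagierPeriods-3721 so the ledger row is shared): on the open unit box let F = A·∏_k
g_k^{s_k} with A, g_k ∈ ℚ[x_1…x_n], g_k > 0 on the open box, s_k ∈ ℚ; if F tends to 0 at both ends
of every fibre in direction i, then [ (0,1)^n, ∂_iF ] (absolute integrability part of the datum) is
a KZ relation — Bitoun–Bogner–Klausen–Panzer's differentiation rule of the Mellin transform (Lemma
7) turned into one Newton–Leibniz move with a RADICAL, hence ℚ-semialgebraic, primitive after
reindexing i last (KZ.IntegralRep.of_sub_of_reindex_mem_relations, proved) plus two null faces.
[difficulty: L] -/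
@[route_item "route-KontsevichZagierPeriods-ExponentCosets"]
def BoxIBPTransfer : Prop :=
  ∀ (n K : ℕ) (i : Fin n) (g : Fin K → MvPolynomial (Fin n) ℚ) (s : Fin K → ℚ) (A : MvPolynomial (Fin n) ℚ), (∀ x : Fin n → ℝ, (∀ j, x j ∈ Set.Ioo (0:ℝ) 1) → ∀ k, 0 < MvPolynomial.aeval x (g k)) → (∀ x : Fin n → ℝ, (∀ j, x j ∈ Set.Ioo (0:ℝ) 1) → Filter.Tendsto (fun t : ℝ => MvPolynomial.aeval (Function.update x i t) A * ∏ k, (MvPolynomial.aeval (Function.update x i t) (g k)) ^ ((s k : ℚ) : ℝ)) (nhdsWithin 0 (Set.Ioi 0)) (nhds 0) ∧ Filter.Tendsto (fun t : ℝ => MvPolynomial.aeval (Function.update x i t) A * ∏ k, (MvPolynomial.aeval (Function.update x i t) (g k)) ^ ((s k : ℚ) : ℝ)) (nhdsWithin 1 (Set.Iio 1)) (nhds 0)) → ∀ (r : Literature.NumberTheory.Transcendental.KZ.IntegralRep n), r.domain = {x | ∀ j, x j ∈ Set.Ioo (0:ℝ) 1} → Set.EqOn r.integrand (fun x => (MvPolynomial.aeval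 x (MvPolynomial.pderiv i A) + MvPolynomial.aeval x A * ∑ k, ((s k : ℚ) : ℝ) * MvPolynomial.aeval x (MvPolynomial.pderiv i (g k)) / MvPolynomial.aeval x (g k)) * ∏ k, (MvPolynomial.aeval x (g k)) ^ ((s k : ℚ) : ℝ)) r.domain → Literature.NumberTheory.Transcendental.KZ.of r ∈ Literature.NumberTheory.Transcendental.KZ.relations

/-- item stmt-KontsevichZagierPeriods-12836 · support · rank 9 · open · by planner
sources: ViuSos2021, KontsevichZagier2001, Literature.NumberTheory.Transcendental.KZ.exists_sub_isBounded, Literature.NumberTheory.Transcendental.KZ.exists_integralRep_sub_holds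
[support] UNIVERSALITY OF THE GRADING: every formal combination c is congruent modulo KZ.relations
to a ℤ-combination of box-Mellin members. Proof plan (all ingredients in the tree): c ≡ [r] − [r′]
(KZ.exists_integralRep_sub_holds); each [r] ≡ [A,1] − [B,1] with A, B BOUNDED
(KZ.exists_sub_isBounded, Viu-Sos' bounded reduction, PROVED); an affine map puts A inside (0,1)^d
(KZ.of_sub_of_mem_changeOfVariablesRel_linear + translation); a ℚ-semialgebraic A ⊂ (0,1)^d is, off
the null set ∪{h_l = 0} of its describing polynomials (tarski_seidenberg_real_holds), the disjoint
union of open sign cells {ε_l h_l > 0} ∩ (0,1)^d (rule 1a; null sets are relations), and [cell, 1]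
is the member with g = (ε_l h_l), e = 0, κ = 1. [difficulty: L] -/
@[route_item "route-KontsevichZagierPeriods-ExponentCosets", crux]
def MellinAccessibility : Prop :=
  ∀ c : Literature.NumberTheory.Transcendental.KZ.FormalRep, ∃ c' ∈ AddSubgroup.closure {d : Literature.NumberTheory.Transcendental.KZ.FormalRep | ∃ (m K : ℕ) (g : Fin K → MvPolynomial (Fin m) ℚ) (e : Fin K → ℚ) (κ : ℚ) (r : Literature.NumberTheory.Transcendental.KZ.IntegralRep m), r.domain = {x | (∀ j, x j ∈ Set.Ioo (0:ℝ) 1) ∧ ∀ k, 0 < MvPolynomial.aeval x (g k)} ∧ Set.EqOn r.integrand (fun x => (κ : ℝ) * ∏ k, (MvPolynomial.aeval x (g k)) ^ ((e k : ℚ) : ℝ)) r.domain ∧ d = Literature.NumberTheory.Transcendental.KZ.of r}, c - c' ∈ Literature.NumberTheory.Transcendental.KZ.relations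

/-- item stmt-KontsevichZagierPeriods-12837 · support · rank 9 · open · by planner
sources: AndrewsAskeyRoy1999, Waldschmidt2006, KontsevichZagier2001
[support] CALIBRATION, the first fibres settled unconditionally (verbatim the retired route's
stmt-KontsevichZagierPeriods-3722): Conjecture 1 holds for any two members κ·x^(a+i−1)(1−x)^(b+j−1),
κ′·x^(a+i′−1)(1−x)^(b+j′−1) of one coset of the Beta family on (0,1) — all values of a coset are
rational multiples of one Beta value by the translation relations B(a+1,b) = a/(a+b)·B(a,b) (one IBP
with primitive x^a(1−x)^b + rule 1b), the T generator of Rohrlich–Lang realised as moves; the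
two-member instance of CosetKernel for g = (x, 1−x). [difficulty: M] -/
@[route_item "route-KontsevichZagierPeriods-ExponentCosets"]
def BetaCosetKZ : Prop :=
  ∀ (a b : ℚ) (i j i' j' : ℤ) (κ κ' : ℚ) (r r' : Literature.NumberTheory.Transcendental.KZ.IntegralRep 1), r.domain = {x | x 0 ∈ Set.Ioo (0:ℝ) 1} → Set.EqOn r.integrand (fun x => (κ : ℝ) * (x 0) ^ ((a : ℝ) + i - 1) * (1 - x 0) ^ ((b : ℝ) + j - 1)) r.domain → r'.domain = {x | x 0 ∈ Set.Ioo (0:ℝ) 1} → Set.EqOn r'.integrand (fun x => (κ' : ℝ) * (x 0) ^ ((a : ℝ) + i' - 1) * (1 - x 0) ^ ((b : ℝ) + j' - 1)) r'.domain → r.value = r'.value → Literature.NumberTheory.Transcendental.KZ.Equivalent r r'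

/-- item stmt-KontsevichZagierPeriods-3169 · support · rank 9 · closed · proved by Summit.KontsevichZagierPeriods.CoactionDevissage.TorsionFree.exceptionalCouplings_torsionFree_proof @ f648441f8c8f (prover) · by planner
sources: KontsevichZagier2001, Literature.NumberTheory.Transcendental.KZ.integrandAddRel, Literature.NumberTheory.Transcendental.KZ.mul_mem_relations_right_holds
[support] P_KZ is torsion-free: n ≠ 0, n • c ∈ KZ.relations ⇒ c ∈ KZ.relations. Proof: c − c·[0,1] ∈
relations (Newton–Leibniz on each generator r with base r, band r.domain × [0,1] = (r.prod
I₀₁).domain, F(x,t) = t·f(x)); c·[0,1] − n • (c·[0,1/n]) ∈ relations (domain additivity into n slabs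
over the null overlaps r.domain × {k/n}, translations t ↦ t − k/n as changes of variables); n •
(c·[0,1/n]) = (n • c)·[0,1/n] ∈ relations by `KZ.mul_mem_relations_right_holds`. Card item D0.
[difficulty: provable-now] -/
@[route_item "route-KontsevichZagierPeriods-ExponentCosets", crux]
def TorsionFree : Prop :=
  ∀ (n : ℕ) (c : Literature.NumberTheory.Transcendental.KZ.FormalRep), n ≠ 0 → n • c ∈ Literature.NumberTheory.Transcendental.KZ.relations → c ∈ Literature.NumberTheory.Transcendental.KZ.relations

/-- item stmt-KontsevichZagierPeriods-12838 · assembly · rank 1 · closed · proved by Summit.KontsevichZagierPeriods.ExponentCosets.assembly_proof @ 91c486c4e96d (prover) · by planner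
sources: KontsevichZagier2001, Literature.NumberTheory.Transcendental.KZ.relations_le_ker_eval_holds
[assembly] MellinAccessibility → CosetDevissage → CosetKernel → TorsionFree →
KontsevichZagierPeriods. -/
@[route_item "route-KontsevichZagierPeriods-ExponentCosets"]
def Assembly : Prop :=
  MellinAccessibility → CosetDevissage → CosetKernel → TorsionFree → KontsevichZagierPeriods

/-! D-0027 §2.1 — DECIDING THEOREM (planner-authored via `route open/edit --closes-file`; by planner-plancard-KontsevichZagierPeriods-Kont-98e2b8a5-g2-0 2026-08-15T18:56:32Z):
its hypotheses are this route's items and its conclusion the sub-problem Statement (glue_lint), and it elaborates with this file. -/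

@[closes "route-KontsevichZagierPeriods-ExponentCosets"] theorem closes (hA : MellinAccessibility) (hD : CosetDevissage) (hK : CosetKernel) (hT : TorsionFree) : KontsevichZagierPeriods := by
  intro n m r r' _ _ hv
  show Literature.NumberTheory.Transcendental.KZ.of r - Literature.NumberTheory.Transcendental.KZ.of r' ∈ Literature.NumberTheory.Transcendental.KZ.relations
  set c := Literature.NumberTheory.Transcendental.KZ.of r - Literature.NumberTheory.Transcendental.KZ.of r' with hc
  have hc0 : Literature.NumberTheory.Transcendental.KZ.eval c = 0 := by
    simp [hc, Literature.NumberTheory.Transcendental.KZ.eval_of, hv]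
  obtain ⟨c', hc'mem, hcc'⟩ := hA c
  have hdiff : Literature.NumberTheory.Transcendental.KZ.eval (c - c') = 0 :=
    Literature.NumberTheory.Transcendental.KZ.relations_le_ker_eval_holds hcc'
  have hc'0 : Literature.NumberTheory.Transcendental.KZ.eval c' = 0 := by
    rw [map_sub, hc0, zero_sub, neg_eq_zero] at hdiff
    exact hdiff
  obtain ⟨N, hN, J, cs, hcs, hrel⟩ := hD c' hc'mem hc'0
  have hcs_rel : ∀ j, cs j ∈ Literature.NumberTheory.Transcendental.KZ.relations := by
    intro j
    obtain ⟨m', K, L, g, e₀, ν, κ, a, rr, hconds, heval, hj⟩ := hcs j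
    rw [hj]
    exact hK m' K L g e₀ ν κ a rr hconds heval
  have hsum : ∑ j, cs j ∈ Literature.NumberTheory.Transcendental.KZ.relations :=
    AddSubgroup.sum_mem _ (fun j _ => hcs_rel j)
  have hNc' : N • c' ∈ Literature.NumberTheory.Transcendental.KZ.relations := by
    have := AddSubgroup.add_mem _ hrel hsum
    simpa using this
  have hc' : c' ∈ Literature.NumberTheory.Transcendental.KZ.relations := hT N c' hN hNc'
  have := AddSubgroup.add_mem _ hcc' hc'
  simpa using this

end Summit.KontsevichZagierPeriods.KontsevichZagierPeriods.Theses.ExponentCosets
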